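import Summits.BirchSwinnertonDyer.BirchSwinnertonDyer.Theorems.ByReductionTypeAtTwoFineSelmerConjAAtTwoAdditivePotGoodClassNumberOneCriterionFrac
import Summits.BirchSwinnertonDyer.BirchSwinnertonDyer.Theorems.ByReductionTypeAtTwoFineSelmerConjAAtTwoAdditivePotGoodCensusDoorStampsB
import HarnessLib

/-!
# Route `ByReductionTypeAtTwo` (rung K4), crux C1″ `FineSelmerConjAAtTwoAdditivePotGood` (item stmt-BirchSwinnertonDyer-22615):
# CLASS NUMBER ONE FOR THE CUBIC FIELD OF DISCRIMINANT `−18495` (`X³ + (0)X² + (33)X + (-29)`, index `3`) BY A NORM CERTIFICATE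
# (KERNEL) — the `2`-torsion point field `ℚ(P)` of the census row `369900c1`, whose census stamp thereby needs NO displayed datum any more ((A)₂ modulo Lim 2017 Thm. 3.5 ALONE)
# (a `--supports 22615` file; seat `bsd-2adic-k4-w1` GEN 6; consumer of `…ClassNumberOneCriterion` / `…ClassNumberOneCriterionFrac`)

HONEST FRAMING (cell `bsd-2adic`, D-0036/D-0054): §1 UNCONDITIONAL kernel arithmetic; §2 conditional on `hLim2` (Lim 2017 Thm. 3.5 at `2`) BY NAME
and NOTHING ELSE; closes nothing at the `∀`-level; nothing booked; BSD is not proved by any of this.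

THE CERTIFICATE (generated by the seat's exact-arithmetic tools — reduced model, integral basis, relation sieve with Dedekind–Kummer
bookkeeping, unit reduction — and CHECKED HERE by the kernel): `g = X³ + (0)X² + (33)X + (-29)`, `disc g = 166455 = 3² · (-18495)`;
the integral element `ω` of the proof shows `3 ∣ [𝓞 K : ℤ[θ]]`, so `|d_K| ≤ 18495` (`sq_mul_abs_discr_le_abs_cubic_discr`) and `M_K < 39`.
For every prime `ℓ < 39` and every root `a` of `g mod ℓ` the proof lists a generator `(x + yθ + zθ²)/m` of the ideals `I ∋ ℓ, θ − a` of norm `ℓ`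
(11 witnesses, 7 of them outside `ℤ[θ]`; the prime 3 dividing the index is certified through a second generator of `𝓞 K` (`exists_intElem_of_scaled_cubic`)). No Dedekind–Kummer theory is invoked in the proof: the criterion only uses `𝓞/I ≅ 𝔽_ℓ`.

References: [Marcus1977] Ch. 2 Exercise 27, Ch. 5 Thm. 35–37; [Cohen1993] §4.8.2, §6.3; [Lim2017FineSelmer] Thm. 3.5, Lemma 3.2;
[Greenberg2001IwasawaPastPresent] Prop. 2.1 (Iwasawa 1956); [Fukuda1994] Thm. 1 (1).
-/

set_option autoImplicit false
-- sibling precedent (`…ClassNumberOneCriterionFrac.lean`): the directory name repeats the summit name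
set_option linter.dupNamespace false

noncomputable section

open scoped Classical IntermediateField NumberField Real nonZeroDivisors

namespace Summit.BirchSwinnertonDyer.BirchSwinnertonDyer.Theorems.AddKatoTwo

open WeierstrassCurve Field Polynomial IsDedekindDomain NumberField Matrix Literature.NumberTheory.EllipticCurves
  Literature.NumberTheory.GaloisRepresentations
  Literature.NumberTheory.IwasawaTheory
  Summit.BirchSwinnertonDyer.BirchSwinnertonDyer.Theorems.AlignedTransportAtTwoTorsionPointField
  Summit.BirchSwinnertonDyer.BirchSwinnertonDyer.Theses.ByReductionTypeAtTwo

/-! ## §1 The certificate: `h = 1` for the field of `X³ + (0)X² + (33)X + (-29)` -/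

section Certificate

variable (K : Type) [Field K] [NumberField K]

/-- `X³ + (0)X² + (33)X + (-29)` is irreducible over `ℚ` (no root mod `2`). -/
theorem irreducible_cubic_d18495n : Irreducible (Cubic.toPoly ⟨1, ((0 : ℤ) : ℚ), ((33 : ℤ) : ℚ), ((-29 : ℤ) : ℚ)⟩) :=
  haveI : Fact (Nat.Prime 2) := ⟨by norm_num⟩
  irreducible_cubic_of_no_root_zmod 2 (by decide)

/-- `X³ + (0)X² + (-45)X + (-175)` is irreducible over `ℚ` (no root mod `2`). -/
theorem irreducible_cubic_d18495n_aux2 : Irreducible (Cubic.toPoly ⟨1, ((0 : ℤ) : ℚ), ((-45 : ℤ) : ℚ), ((-175 : ℤ) : ℚ)⟩) :=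
  haveI : Fact (Nat.Prime 2) := ⟨by norm_num⟩
  irreducible_cubic_of_no_root_zmod 2 (by decide)

/-- **`h = 1` for every cubic number field whose integers contain a root `θ` of `X³ + (0)X² + (33)X + (-29)`** (`|disc| = 166455`, index
`3`, `M_K < 39`): a norm certificate — for every prime `ℓ < 39` and every root `a` of the cubic mod `ℓ` a generator
`(x + yθ + zθ²)/m ∈ 𝓞 K` of every ideal `I ∋ ℓ, θ − a` of norm `ℓ` (listed in the proof; `m > 1` = element of `𝓞 K ∖ ℤ[θ]`, certified by its
scaled cubic identity); the primes dividing the index (3) are certified through a second generator of `𝓞 K`. KERNEL.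
[cite: Marcus1977, Ch. 5 Thm. 37 and Cor. 2] [cite: Cohen1993, §6.3] -/
theorem classNumber_eq_one_of_root_d18495n (h3 : Module.finrank ℚ K = 3) (b : 𝓞 K)
    (hb : b ^ 3 + (0 : ℤ) * b ^ 2 + (33 : ℤ) * b + (-29 : ℤ) = 0) : NumberField.classNumber K = 1 := by
  have hirr := irreducible_cubic_d18495n
  -- `ω = (1 + 2θ + 1θ²)/3 ∈ 𝓞 K` witnesses `3 ∣ [𝓞 K : ℤ[θ]]`, so `3² · |d_K| ≤ |disc| = 166455`
  obtain ⟨ω, hω, -⟩ := exists_intElem_of_scaled_cubic K b 1 2 1 (m := 3) (by norm_num) 21 102 (-147)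
    (by push_cast; linear_combination ((103 : 𝓞 K) + (45 : 𝓞 K) * b + (6 : 𝓞 K) * b ^ 2 + (1 : 𝓞 K) * b ^ 3) * hb)
  have hd : |NumberField.discr K| ≤ (18495 : ℕ) :=
    abs_discr_le_of_sq_mul_le K (k := 3) (by norm_num)
      (sq_mul_abs_discr_le_abs_cubic_discr K h3 b hirr hb (by norm_num) 1 2 1 ⟨ω, hω⟩ (by norm_num))
      (by simp only [Cubic.discr]; norm_num)
  -- second generator `b2 = (22 + 2θ + 1θ²)/3`, a root of `X³ + (0)X² + (-45)X + (-175)` (index 5, prime to 3)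
  obtain ⟨b2, -, hb2⟩ := exists_intElem_of_scaled_cubic K b 22 2 1 (m := 3) (by norm_num) 0 (-45) (-175)
    (by push_cast; linear_combination ((103 : 𝓞 K) + (45 : 𝓞 K) * b + (6 : 𝓞 K) * b ^ 2 + (1 : 𝓞 K) * b ^ 3) * hb)
  have hirr2 := irreducible_cubic_d18495n_aux2
  refine classNumber_eq_one_of_prime_norm_principal K h3 (B := 39)
    (minkowskiBound_lt_of_sqrt_le K h3 hd (s := 136.00)
      ((Real.sqrt_le_sqrt (by norm_num : ((18495 : ℕ) : ℝ) ≤ (136.00 : ℝ) ^ 2)).trans (Real.sqrt_sq (by norm_num)).le)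
      (by norm_num)) ?_
  intro ℓ hℓB hℓ J hJ
  interval_cases ℓ <;> norm_num at hℓ
  · -- `ℓ = 2`: roots none
    refine isPrincipal_of_absNorm_eq_prime K h3 b hirr hb (by norm_num) (fun a ha hdvd => ?_) hJ
    interval_cases a <;> norm_num at hdvd
  · -- `ℓ = 3`: roots [1] (second generator `b2`)
    refine isPrincipal_of_absNorm_eq_prime_frac K h3 b2 hirr2 hb2 (by norm_num) (fun a ha hdvd => ?_) hJ
    interval_cases a <;> norm_num at hdvd
    · exact ⟨(-15), 10, (-1), 5, by norm_num, by norm_num,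
        (exists_intElem_of_scaled_cubic K b2 (-15) 10 (-1) (m := 5) (by norm_num) 27 246 (-3)
          (by push_cast; linear_combination ((375 : 𝓞 K) + (-255 : 𝓞 K) * b2 + (30 : 𝓞 K) * b2 ^ 2 + (-1 : 𝓞 K) * b2 ^ 3) * hb2)).imp (fun _ h => h.1), by norm_num⟩
  · -- `ℓ = 5`: roots [1, 2]
    refine isPrincipal_of_absNorm_eq_prime_frac K h3 b hirr hb (by norm_num) (fun a ha hdvd => ?_) hJ
    interval_cases a <;> norm_num at hdvd
    · exact ⟨(-1), 1, 0, 1, by norm_num, by norm_num, ⟨_, by rw [Nat.cast_one, one_mul]⟩, by norm_num⟩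
    · exact ⟨13, (-16), 1, 3, by norm_num, by norm_num,
        (exists_intElem_of_scaled_cubic K b 13 (-16) 1 (m := 3) (by norm_num) 9 1080 5
          (by push_cast; linear_combination ((-4595 : 𝓞 K) + (801 : 𝓞 K) * b + (-48 : 𝓞 K) * b ^ 2 + (1 : 𝓞 K) * b ^ 3) * hb)).imp (fun _ h => h.1), by norm_num⟩
  · -- `ℓ = 7`: roots [6]
    refine isPrincipal_of_absNorm_eq_prime_frac K h3 b hirr hb (by norm_num) (fun a ha hdvd => ?_) hJ
    interval_cases a <;> norm_num at hdvd
    · exact ⟨8, (-11), 2, 3, by norm_num, by norm_num,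
        (exists_intElem_of_scaled_cubic K b 8 (-11) 2 (m := 3) (by norm_num) 36 927 (-7)
          (by push_cast; linear_combination ((-2551 : 𝓞 K) + (990 : 𝓞 K) * b + (-132 : 𝓞 K) * b ^ 2 + (8 : 𝓞 K) * b ^ 3) * hb)).imp (fun _ h => h.1), by norm_num⟩
  · -- `ℓ = 11`: roots [6]
    refine isPrincipal_of_absNorm_eq_prime K h3 b hirr hb (by norm_num) (fun a ha hdvd => ?_) hJ
    interval_cases a <;> norm_num at hdvd
    · exact ⟨7, (-9), 1, by norm_num, by norm_num⟩
  · -- `ℓ = 13`: roots none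
    refine isPrincipal_of_absNorm_eq_prime K h3 b hirr hb (by norm_num) (fun a ha hdvd => ?_) hJ
    interval_cases a <;> norm_num at hdvd
  · -- `ℓ = 17`: roots none
    refine isPrincipal_of_absNorm_eq_prime K h3 b hirr hb (by norm_num) (fun a ha hdvd => ?_) hJ
    interval_cases a <;> norm_num at hdvd
  · -- `ℓ = 19`: roots none
    refine isPrincipal_of_absNorm_eq_prime K h3 b hirr hb (by norm_num) (fun a ha hdvd => ?_) hJ
    interval_cases a <;> norm_num at hdvd
  · -- `ℓ = 23`: roots [15]
    refine isPrincipal_of_absNorm_eq_prime_frac K h3 b hirr hb (by norm_num) (fun a ha hdvd => ?_) hJ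
    interval_cases a <;> norm_num at hdvd
    · exact ⟨(-2), 2, 1, 3, by norm_num, by norm_num,
        (exists_intElem_of_scaled_cubic K b (-2) 2 1 (m := 3) (by norm_num) 24 147 (-23)
          (by push_cast; linear_combination ((103 : 𝓞 K) + (45 : 𝓞 K) * b + (6 : 𝓞 K) * b ^ 2 + (1 : 𝓞 K) * b ^ 3) * hb)).imp (fun _ h => h.1), by norm_num⟩
  · -- `ℓ = 29`: roots [0, 5, 24]
    refine isPrincipal_of_absNorm_eq_prime_frac K h3 b hirr hb (by norm_num) (fun a ha hdvd => ?_) hJ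
    interval_cases a <;> norm_num at hdvd
    · exact ⟨0, 1, 0, 1, by norm_num, by norm_num, ⟨_, by rw [Nat.cast_one, one_mul]⟩, by norm_num⟩
    · exact ⟨(-6), 7, 0, 1, by norm_num, by norm_num, ⟨_, by rw [Nat.cast_one, one_mul]⟩, by norm_num⟩
    · exact ⟨55, (-70), 7, 3, by norm_num, by norm_num,
        (exists_intElem_of_scaled_cubic K b 55 (-70) 7 (m := 3) (by norm_num) 99 23994 (-29)
          (by push_cast; linear_combination ((-446243 : 𝓞 K) + (114219 : 𝓞 K) * b + (-10290 : 𝓞 K) * b ^ 2 + (343 : 𝓞 K) * b ^ 3) * hb)).imp (fun _ h => h.1), by norm_num⟩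
  · -- `ℓ = 31`: roots [28]
    refine isPrincipal_of_absNorm_eq_prime_frac K h3 b hirr hb (by norm_num) (fun a ha hdvd => ?_) hJ
    interval_cases a <;> norm_num at hdvd
    · exact ⟨2396, 61, 71, 3, by norm_num, by norm_num,
        (exists_intElem_of_scaled_cubic K b 2396 61 71 (m := 3) (by norm_num) (-834) 309 (-31)
          (by push_cast; linear_combination ((20753933 : 𝓞 K) + (12603636 : 𝓞 K) * b + (922503 : 𝓞 K) * b ^ 2 + (357911 : 𝓞 K) * b ^ 3) * hb)).imp (fun _ h => h.1), by norm_num⟩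
  · -- `ℓ = 37`: roots [11]
    refine isPrincipal_of_absNorm_eq_prime_frac K h3 b hirr hb (by norm_num) (fun a ha hdvd => ?_) hJ
    interval_cases a <;> norm_num at hdvd
    · exact ⟨(-1), 1, (-1), 3, by norm_num, by norm_num,
        (exists_intElem_of_scaled_cubic K b (-1) 1 (-1) (m := 3) (by norm_num) (-21) 120 37
          (by push_cast; linear_combination ((5 : 𝓞 K) + (-36 : 𝓞 K) * b + (3 : 𝓞 K) * b ^ 2 + (-1 : 𝓞 K) * b ^ 3) * hb)).imp (fun _ h => h.1), by norm_num⟩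

end Certificate

/-! ## §2 The census row `369900c1` -/

/-- **(A)₂ for the census curve `369900c1` modulo Lim 2017 Thm. 3.5 ALONE — NO displayed datum.** Its `2`-torsion cubic field
(`d = -18495`) has `h = 1` BY THE KERNEL (`classNumber_eq_one_of_root_d18495n`): the element
`θ = 10207902/137 + (7628/2055)·β + (-19/51375)·β²` of `ℚ(β)` (`β` a root of the `2`-division cubic) is a root of `X³ + (0)X² + (33)X + (-29)` and
`β = 18810 + (735)·θ + (855)·θ²`, so `ℚ(P) = ℚ(β) = ℚ(θ)` (identities = `linear_combination`s of the `2`-division relation; coefficients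
found by exact linear algebra in `ℚ[X]/(G)`). UPGRADES `conjA_two_369900c1_of_oddClassNumber`. [cite: Lim2017FineSelmer, §3 Thm. 3.5 and Lemma 3.2]
[cite: Greenberg2001IwasawaPastPresent, Prop. 2.1 p. 339] [cite: Cohen1993, §6.3] -/
theorem conjA_two_369900c1
    (hLim2 : Lim2017.thm35_at_two_fineSelmerDual_moduleFinite_of_classicalMuVanishes_of_le_divisionField_four)
    (κ : ZpExtension ℚ 2) (hκ : κ.IsCyclotomic) :
    haveI := isElliptic_369900c1'
    ∃ (γ : absoluteGaloisGroup ℚ) (D : (⟨0, ((0 : ℤ) : ℚ), 0, ((-302207625 : ℤ) : ℚ), ((-2022116821875 : ℤ) : ℚ)⟩ : WeierstrassCurve ℚ).FineSelmerDualData κ γ),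
      Module.Finite ℤ_[2] (RestrictScalars ℤ_[2] (IwasawaAlgebra 2) D.X) := by
  haveI := isElliptic_369900c1'
  obtain ⟨β, hβ⟩ : ∃ β : AlgebraicClosure ℚ, aeval β (Cubic.toPoly ⟨1, ((0 : ℤ) : ℚ), ((-302207625 : ℤ) : ℚ), ((-2022116821875 : ℤ) : ℚ)⟩) = 0 :=
    IsAlgClosed.exists_aeval_eq_zero _ _ (by rw [Cubic.degree_of_a_ne_zero one_ne_zero]; norm_num)
  have hβ' : β ^ 3 + (0 : AlgebraicClosure ℚ) * β ^ 2 + (-302207625 : AlgebraicClosure ℚ) * β + (-2022116821875 : AlgebraicClosure ℚ) = 0 := by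
    have := hβ
    simp only [Cubic.toPoly, map_one, one_mul, aeval_add, aeval_mul, aeval_C, aeval_X_pow, aeval_X,
      eq_ratCast, Rat.cast_intCast] at this
    push_cast at this
    linear_combination this
  set θ : AlgebraicClosure ℚ := algebraMap ℚ (AlgebraicClosure ℚ) (10207902 / 137 : ℚ) +
      algebraMap ℚ (AlgebraicClosure ℚ) (7628 / 2055 : ℚ) * β + algebraMap ℚ (AlgebraicClosure ℚ) (-19 / 51375 : ℚ) * β ^ 2 with hθdef
  have hθ : aeval θ (Cubic.toPoly ⟨1, ((0 : ℤ) : ℚ), ((33 : ℤ) : ℚ), ((-29 : ℤ) : ℚ)⟩) = 0 := by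
    simp only [Cubic.toPoly, map_one, one_mul, aeval_add, aeval_mul, aeval_C, aeval_X_pow, aeval_X, eq_ratCast,
      Rat.cast_intCast]
    rw [hθdef]
    simp only [eq_ratCast]
    push_cast
    linear_combination (((-355064300849 : AlgebraicClosure ℚ) / 1735663275) + ((-931 : AlgebraicClosure ℚ) / 2639390625) * β + ((2753708 : AlgebraicClosure ℚ) / 1807982578125) * β ^ 2 + ((-6859 : AlgebraicClosure ℚ) / 135598693359375) * β ^ 3) * hβ'
  have hadj : IntermediateField.adjoin ℚ {θ} = IntermediateField.adjoin ℚ {β} := by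
    apply le_antisymm
    · rw [IntermediateField.adjoin_simple_le_iff, hθdef]
      have hβmem := IntermediateField.mem_adjoin_simple_self ℚ β
      exact add_mem (add_mem (algebraMap_mem _ _) (mul_mem (algebraMap_mem _ _) hβmem))
        (mul_mem (algebraMap_mem _ _) (pow_mem hβmem 2))
    · rw [IntermediateField.adjoin_simple_le_iff]
      have hβeq : β = algebraMap ℚ (AlgebraicClosure ℚ) (18810 : ℚ) + algebraMap ℚ (AlgebraicClosure ℚ) (735 : ℚ) * θ +
          algebraMap ℚ (AlgebraicClosure ℚ) (855 : ℚ) * θ ^ 2 := by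
        rw [hθdef]; simp only [eq_ratCast]; push_cast; linear_combination (((5507416 : AlgebraicClosure ℚ) / 2346125) + ((-6859 : AlgebraicClosure ℚ) / 58653125) * β) * hβ'
      rw [hβeq]
      have hθmem := IntermediateField.mem_adjoin_simple_self ℚ θ
      exact add_mem (add_mem (algebraMap_mem _ _) (mul_mem (algebraMap_mem _ _) hθmem))
        (mul_mem (algebraMap_mem _ _) (pow_mem hθmem 2))
  refine conjA_two_369900c1_of_oddClassNumber hLim2 hβ ?_ κ hκ
  rw [← hadj]
  exact not_two_dvd_card_classGroup_adjoin_of_forall_cubicField irreducible_cubic_d18495n (classNumber_eq_one_of_root_d18495n) hθ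

end Summit.BirchSwinnertonDyer.BirchSwinnertonDyer.Theorems.AddKatoTwo

end
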